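import Literature.AlgebraicGeometry.RelativeSpec.FiniteGroupQuotientGluedProperties
import Literature.AlgebraicGeometry.RelativeSpec.SymmetricPowerGlued
import Literature.AlgebraicGeometry.Resolution.FiniteQuotientSingularityPresentation
import Literature.AlgebraicGeometry.Motives.SmoothOverRegularBase
import Literature.AlgebraicGeometry.Motives.JacobianDimensionOfBirationalSymmetricPower
import Mathlib.RingTheory.Flat.Basic
import HarnessLib

/-!
# Symmetric powers of smooth varieties, and their products, are normal

Let `X → Spec K` be smooth and separated, with every finite subset in an affine open, and
`X⁽ⁿ⁾ = Xⁿ/𝔖ₙ` the glued symmetric power (`RelativeSpec/SymmetricPowerGlued`, Milne, *Jacobian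
Varieties*, §3 Prop. 3.1; Mumford, *Abelian Varieties*, §7). This file proves:

* `isIntegrallyClosed_stalk_symPowGlued` — **`X⁽ⁿ⁾` is normal**: `X⁽ⁿ⁾` is covered by the charts
  `Spec Γ(O)^{𝔖ₙ}` (`ActionOver.isOpenImmersion_chart`, `exists_mem_range_chart`, `chart_gluedDesc`)
  of the `𝔖ₙ`-stable affine opens `O = Wⁿ`, whose rings `Γ(O)` are regular — hence integrally
  closed — domains (`isIntegrallyClosed_sections_of_smoothOfRelativeDimension`, Görtz–Wedhorn I
  Lemma 6.26 with Matsumura 19.4), and rings of invariants of integrally closed domains are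
  integrally closed domains (`isIntegrallyClosed_fixedPoints_subring`);
* `isIntegrallyClosed_stalk_pullback_symPowGlued_base` — **`X⁽ⁿ⁾ ×_K X⁽ᵐ⁾` is normal** in
  characteristic zero: it is covered by `Spec (Γ(O₁)^{𝔖ₙ} ⊗_K Γ(O₂)^{𝔖ₘ})`
  (`ActionOver.exists_chart_pullback_glued`, Mathlib `pullbackSpecIso`), and **`A^G ⊗_K B^H` is an
  integrally closed domain whenever `A ⊗_K B` is** (`isDomain_and_isIntegrallyClosed_tensorProduct_fixedPoints`):
  `A^G ⊗_K B^H ↪ A ⊗_K B` by flatness over the field, with the `A^G ⊗_K B^H`-linear Reynolds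
  retraction `ρ_G ⊗ ρ_H` (`exists_reynolds`), and normality descends along such retractions
  (`IsIntegrallyClosed.of_retraction`); here `A ⊗_K B = Γ(O₁ ×_K O₂)` for the smooth affine
  `O₁ ×_K O₂` (`isDomain_and_isIntegrallyClosed_tensor_sections`);
* `Motives.symPowProj.isIntegrallyClosed_stalk`, `Motives.symPowProj.isIntegrallyClosed_stalk_tensor`
  — the same for the projective symmetric powers `C⁽ⁿ⁾ = symPowProj C hC n` of
  `Motives/SymmetricPowerProjective` and `C⁽ⁿ⁾ ×_K C⁽ᵐ⁾`.

For a smooth CURVE `C^{(n)}` is even nonsingular (Milne §3 Prop. 3.2, via symmetric functions);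
normality is what Weil's construction of the Jacobian needs (morphisms with closed graph out of
opens of `C^{(g)}` and `C^{(g)} × C^{(g)}` are defined, `Motives/ClosedGraphMorphism`,
`Motives/CurveLinearSystemMorphism`). Everything is proved; no definitions, no named facts.

Mathlib searched (pin): `pullbackSpecIso`, `Scheme.isoSpec_inv_naturality`, `Scheme.Pullback.range_map`,
`MorphismProperty.pullbackMap`, `TensorProduct.map_injective_of_flat_flat`, `FixedPoints.subalgebra`,
`MulSemiringAction.toAlgHom`, `IsFractionRing.liftAlgHom`, `IsIntegrallyClosed.of_equiv`,
`IsIntegrallyClosed.of_localization_maximal` (all used); Mathlib has `Algebra.IsInvariant` but not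
the normality of rings of invariants nor symmetric powers of schemes.

## References

* J. S. Milne, *Jacobian Varieties*, in Cornell–Silverman (eds.), *Arithmetic Geometry* (1986),
  §3 Prop. 3.1, Prop. 3.2, §7. [Milne1986JacobianVarieties]
* D. Mumford, *Abelian Varieties* (1970), §7, Thm. p. 66. [MumfordAV1970]
* U. Görtz, T. Wedhorn, *Algebraic Geometry I*, 2nd ed. (2020), Lemma 6.26. [GortzWedhorn2020]
* H. Matsumura, *Commutative Ring Theory* (1986), Thm. 19.4. [Matsumura1987]
-/

noncomputable section

universe u

open CategoryTheory CategoryTheory.Limits AlgebraicGeometry TopologicalSpace Opposite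

section Algebra

open TensorProduct

namespace Literature.AlgebraicGeometry.RelativeSpec

/-! ### Normality descends along retractions -/

/-- **Normality descends along a linear retraction.** Let `f : R → T` be an injective homomorphism
of domains with `T` integrally closed, and `ρ : T → R` an additive retraction (`ρ (f r) = r`)
which is `R`-linear (`ρ (f r · t) = r · ρ t`) — e.g. a Reynolds operator. Then `R` is integrally
closed: an element `a/b` of `Frac R` integral over `R` is integral over `T`, hence `f a = f b · t`
with `t ∈ T`, and applying `ρ` gives `a = b · ρ t`, i.e. `a/b = ρ t ∈ R` (the argument of
"invariants of a normal domain are normal"). [folklore] -/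
theorem IsIntegrallyClosed.of_retraction {R T : Type*} [CommRing R] [CommRing T] [IsDomain R]
    [IsDomain T] [IsIntegrallyClosed T] (f : R →+* T) (hf : Function.Injective f) (ρ : T →+ R)
    (hρ₁ : ∀ r, ρ (f r) = r) (hρ₂ : ∀ r t, ρ (f r * t) = r * ρ t) : IsIntegrallyClosed R := by
  letI : Algebra R T := f.toAlgebra
  have hinj : Function.Injective (Algebra.ofId R (FractionRing T)) := by
    intro a b hab
    apply hf
    change algebraMap R T a = algebraMap R T b
    apply IsFractionRing.injective T (FractionRing T)
    simpa [Algebra.ofId_apply, IsScalarTower.algebraMap_apply R T (FractionRing T)] using hab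
  let ψ : FractionRing R →ₐ[R] FractionRing T := IsFractionRing.liftAlgHom hinj
  refine (isIntegrallyClosed_iff (FractionRing R)).mpr fun {x} hx ↦ ?_
  obtain ⟨a, b, hb, rfl⟩ := IsFractionRing.div_surjective (A := R) x
  have hb0 : b ≠ 0 := nonZeroDivisors.ne_zero hb
  have h1 : IsIntegral R (ψ (algebraMap R _ a / algebraMap R _ b)) := hx.map ψ
  have h2 : IsIntegral T (ψ (algebraMap R _ a / algebraMap R _ b)) := h1.tower_top
  obtain ⟨t, ht⟩ := IsIntegrallyClosed.algebraMap_eq_of_integral h2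
  have hψ : ψ (algebraMap R _ a / algebraMap R _ b) =
      algebraMap T (FractionRing T) (f a) / algebraMap T (FractionRing T) (f b) := by
    rw [map_div₀, AlgHom.commutes, AlgHom.commutes]
    rfl
  rw [hψ] at ht
  have hfb : algebraMap T (FractionRing T) (f b) ≠ 0 := fun h ↦
    hb0 (hf ((IsFractionRing.injective T (FractionRing T)) (by rw [h, map_zero, map_zero])))
  have ht' : f b * t = f a := by
    apply IsFractionRing.injective T (FractionRing T)
    rw [map_mul, ht, mul_div_cancel₀ _ hfb]
  have key : b * ρ t = a := by rw [← hρ₂, ht', hρ₁]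
  refine ⟨ρ t, ?_⟩
  rw [eq_div_iff ((map_ne_zero_iff _ (IsFractionRing.injective R (FractionRing R))).mpr hb0),
    ← map_mul, mul_comm, key]

/-! ### Reynolds operators -/

section Reynolds

variable (K A : Type*) [Field K] [CharZero K] [CommRing A] [Algebra K A] (G : Type*) [Group G]
  [Finite G] [MulSemiringAction G A] [SMulCommClass G K A]

/-- **The Reynolds operator** `a ↦ |G|⁻¹ Σ_g g·a` (characteristic zero): a `K`-linear retraction of
`A` onto the ring of invariants `A^G` which is `A^G`-linear. [folklore] -/
theorem exists_reynolds :
    ∃ ρ : A →ₗ[K] FixedPoints.subalgebra K A G,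
      (∀ a : FixedPoints.subalgebra K A G, ρ a = a) ∧
      (∀ (a : FixedPoints.subalgebra K A G) (x : A), ρ (a * x) = a * ρ x) := by
  classical
  haveI := Fintype.ofFinite G
  have hcard : (Fintype.card G : K) ≠ 0 := Nat.cast_ne_zero.mpr Fintype.card_ne_zero
  -- the averaging map `A → A`
  let σ : A →ₗ[K] A := ∑ g : G, (MulSemiringAction.toAlgHom K A g).toLinearMap
  have hσ : ∀ x, σ x = ∑ g : G, g • x := fun x ↦ by
    simp only [σ, LinearMap.coe_sum, Finset.sum_apply, AlgHom.toLinearMap_apply,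
      MulSemiringAction.toAlgHom_apply]
  have hσfix : ∀ (h : G) (x : A), h • σ x = σ x := fun h x ↦ by
    rw [hσ, Finset.smul_sum]
    simp_rw [smul_smul]
    exact Fintype.sum_equiv (Equiv.mulLeft h) _ _ fun g ↦ rfl
  let ρ₀ : A →ₗ[K] A := (Fintype.card G : K)⁻¹ • σ
  have hρ₀mem : ∀ x, ρ₀ x ∈ FixedPoints.subalgebra K A G := fun x h ↦ by
    change h • ((Fintype.card G : K)⁻¹ • σ x) = (Fintype.card G : K)⁻¹ • σ x
    rw [smul_comm, hσfix]
  refine ⟨LinearMap.codRestrict (FixedPoints.subalgebra K A G).toSubmodule ρ₀ hρ₀mem, ?_, ?_⟩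
  · intro a
    apply Subtype.ext
    change (Fintype.card G : K)⁻¹ • σ a = a
    rw [hσ]
    have : ∀ g : G, g • (a : A) = a := fun g ↦ a.2 g
    simp_rw [this]
    rw [Finset.sum_const, Finset.card_univ, ← Nat.cast_smul_eq_nsmul K, smul_smul,
      inv_mul_cancel₀ hcard, one_smul]
  · intro a x
    apply Subtype.ext
    change (Fintype.card G : K)⁻¹ • σ (a * x) = a * ((Fintype.card G : K)⁻¹ • σ x)
    rw [hσ, hσ, mul_smul_comm, Finset.mul_sum]
    congr 1
    refine Finset.sum_congr rfl fun g _ ↦ ?_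
    rw [smul_mul', a.2 g]

end Reynolds

/-! ### `A^G ⊗_K B^H` is a normal domain when `A ⊗_K B` is -/

section Tensor

variable (K : Type*) [Field K] [CharZero K]
  (A B : Type*) [CommRing A] [Algebra K A] [CommRing B] [Algebra K B]
  (G H : Type*) [Group G] [Finite G] [Group H] [Finite H]
  [MulSemiringAction G A] [SMulCommClass G K A] [MulSemiringAction H B] [SMulCommClass H K B]

omit [CharZero K] [Finite G] [Finite H] in
/-- The inclusion `A^G ⊗_K B^H → A ⊗_K B` is injective (modules over a field are flat). [folklore] -/
theorem injective_tensorProduct_map_val :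
    Function.Injective (Algebra.TensorProduct.map (FixedPoints.subalgebra K A G).val
      (FixedPoints.subalgebra K B H).val) := by
  have h : (Algebra.TensorProduct.map (FixedPoints.subalgebra K A G).val
      (FixedPoints.subalgebra K B H).val).toLinearMap =
      TensorProduct.map (FixedPoints.subalgebra K A G).val.toLinearMap
        (FixedPoints.subalgebra K B H).val.toLinearMap := by
    ext a b
    rfl
  rw [← AlgHom.coe_toLinearMap, h]
  exact TensorProduct.map_injective_of_flat_flat _ _ Subtype.val_injective Subtype.val_injective

/-- **If `A ⊗_K B` is a normal domain, so is `A^G ⊗_K B^H`** for finite groups `G`, `H` acting on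
the `K`-algebras `A`, `B` (characteristic zero): `A^G ⊗_K B^H` embeds into `A ⊗_K B`
(flatness over the field `K`) with the `A^G ⊗_K B^H`-linear Reynolds retraction
`ρ_G ⊗ ρ_H`, and normality descends along such retractions (`IsIntegrallyClosed.of_retraction`).
This is the algebra behind the normality of products `X/G × Y/H` of quotients of smooth affine
varieties by finite groups. [folklore] -/
theorem isDomain_and_isIntegrallyClosed_tensorProduct_fixedPoints [IsDomain (A ⊗[K] B)]
    [IsIntegrallyClosed (A ⊗[K] B)] :
    IsDomain (FixedPoints.subalgebra K A G ⊗[K] FixedPoints.subalgebra K B H) ∧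
      IsIntegrallyClosed (FixedPoints.subalgebra K A G ⊗[K] FixedPoints.subalgebra K B H) := by
  set ι := Algebra.TensorProduct.map (FixedPoints.subalgebra K A G).val (FixedPoints.subalgebra K B H).val
  have hι : Function.Injective ι := injective_tensorProduct_map_val K A B G H
  haveI : IsDomain (FixedPoints.subalgebra K A G ⊗[K] FixedPoints.subalgebra K B H) :=
    hι.isDomain ι.toRingHom
  refine ⟨inferInstance, ?_⟩
  obtain ⟨ρA, hρA₁, hρA₂⟩ := exists_reynolds K A G
  obtain ⟨ρB, hρB₁, hρB₂⟩ := exists_reynolds K B H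
  let ρ : A ⊗[K] B →ₗ[K] FixedPoints.subalgebra K A G ⊗[K] FixedPoints.subalgebra K B H :=
    TensorProduct.map ρA ρB
  refine IsIntegrallyClosed.of_retraction ι.toRingHom hι ρ.toAddMonoidHom ?_ ?_
  · intro r
    change ρ (ι r) = r
    induction r using TensorProduct.induction_on with
    | zero => simp
    | tmul a b =>
      change ρ ((a : A) ⊗ₜ (b : B)) = a ⊗ₜ b
      simp only [ρ, TensorProduct.map_tmul, hρA₁, hρB₁]
    | add x y hx hy => rw [map_add, map_add, hx, hy]
  · intro r t
    change ρ (ι r * t) = r * ρ t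
    induction t using TensorProduct.induction_on with
    | zero => simp
    | tmul a b =>
      induction r using TensorProduct.induction_on with
      | zero => simp
      | tmul a' b' =>
        change ρ (((a' : A) ⊗ₜ (b' : B)) * (a ⊗ₜ b)) = (a' ⊗ₜ b') * ρ (a ⊗ₜ b)
        simp only [ρ, Algebra.TensorProduct.tmul_mul_tmul, TensorProduct.map_tmul, hρA₂, hρB₂]
      | add x y hx hy => rw [map_add, add_mul, map_add, hx, hy, add_mul]
    | add x y hx hy => rw [mul_add, map_add, hx, hy, map_add, mul_add]

end Tensor

end Literature.AlgebraicGeometry.RelativeSpec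

end Algebra

namespace Literature.AlgebraicGeometry.RelativeSpec

namespace ActionOver

variable {X Y : Scheme.{u}} {r : X ⟶ Y} {G : Type*} [Group G] (ρ : ActionOver r G)
  [Finite G] [Y.IsSeparated] [IsSeparated r] [IsAffine Y]
  (hcov : ∀ x : X, ∃ O : ρ.StableAffineOpens, x ∈ O.1)

/-- **The affine charts of the glued quotient `X/G` over an affine base.** For a `G`-stable open
`O` affine over `Y`, the chart `Spec Γ(O)^G = Spec ((ρ|_O).invariants.ring ⊤) → O/G ↪ X/G` is an
open immersion. [folklore] -/
theorem isOpenImmersion_chart (O : ρ.StableAffineOpens) :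
    IsOpenImmersion ((ρ.restrict O.1 O.2.1).invariants.openCover.f ⟨⊤, isAffineOpen_top Y⟩ ≫
      ρ.gluedι O) := inferInstance

omit [Y.IsSeparated] in
/-- The chart of `O` covers `O/G`. [folklore] -/
theorem range_openCover_f_top (O : ρ.StableAffineOpens) :
    Set.range ((ρ.restrict O.1 O.2.1).invariants.openCover.f ⟨⊤, isAffineOpen_top Y⟩) = Set.univ := by
  have h := (ρ.restrict O.1 O.2.1).invariants.fromSpec_preimage ⟨⊤, isAffineOpen_top Y⟩
  have h' : ((ρ.restrict O.1 O.2.1).invariants.openCover.f ⟨⊤, isAffineOpen_top Y⟩).opensRange = ⊤ :=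
    h.symm.trans rfl
  have h'' := congrArg SetLike.coe h'
  simpa using h''

include hcov in
/-- **The charts cover `X/G`**: every point lies in the chart of a stable affine open containing
one of its preimages in `X`. [folklore] -/
theorem exists_mem_range_chart (z : ρ.glued) : ∃ (O : ρ.StableAffineOpens) (x : X), x ∈ O.1 ∧
    z ∈ Set.range ((ρ.restrict O.1 O.2.1).invariants.openCover.f ⟨⊤, isAffineOpen_top Y⟩ ≫
      ρ.gluedι O) := by
  obtain ⟨x, rfl⟩ := ρ.gluedMk_surjective hcov z
  obtain ⟨O, hx⟩ := hcov x
  refine ⟨O, x, hx, ?_⟩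
  obtain ⟨p, hp⟩ : ρ.pieceMk O ⟨x, hx⟩ ∈
      Set.range ((ρ.restrict O.1 O.2.1).invariants.openCover.f ⟨⊤, isAffineOpen_top Y⟩) := by
    rw [range_openCover_f_top]; trivial
  refine ⟨p, ?_⟩
  rw [Scheme.Hom.comp_apply, hp]
  exact (ρ.gluedMk_apply hcov O ⟨x, hx⟩).symm

/-- **The chart is compatible with the structure maps**: `chart ≫ (X/G → Y)` is
`Spec (Γ(Y, ⊤) → Γ(O)^G)` followed by `Spec Γ(Y, ⊤) ≅ Y`. [folklore] -/
theorem chart_gluedDesc (O : ρ.StableAffineOpens) :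
    ((ρ.restrict O.1 O.2.1).invariants.openCover.f ⟨⊤, isAffineOpen_top Y⟩ ≫ ρ.gluedι O) ≫
        ρ.gluedDesc r ρ.aut_comp =
      Spec.map ((ρ.restrict O.1 O.2.1).invariants.diagramMap.app (op ⊤)) ≫ Y.isoSpec.inv := by
  rw [Category.assoc, ρ.gluedι_gluedDesc_base, ← IsAffineOpen.fromSpec_top]
  exact (ρ.restrict O.1 O.2.1).invariants.ι_fromSpec ⟨⊤, isAffineOpen_top Y⟩

end ActionOver

/-! ### Rings of invariants of normal domains -/

/-- **The ring of invariants of a group acting on an integrally closed domain is an integrally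
closed domain** (`a/b ∈ Frac(S^G)` integral over `S^G` is integral over `S`, so `a = b s` with
`s ∈ S`, and `s` is invariant since `a`, `b ≠ 0` are; cf. the tree's
`isIntegrallyClosed_fixedPointsSubalgebra`, here for Mathlib's `FixedPoints.subring` and a group
in any universe). [folklore] -/
theorem isIntegrallyClosed_fixedPoints_subring (S : Type*) [CommRing S] [IsDomain S]
    [IsIntegrallyClosed S] (G : Type*) [Group G] [MulSemiringAction G S] :
    IsIntegrallyClosed (FixedPoints.subring S G) := by
  set A := FixedPoints.subring S G
  have hinj : Function.Injective (Algebra.ofId A (FractionRing S)) := by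
    intro a b hab
    apply Subtype.val_injective
    apply IsFractionRing.injective S (FractionRing S)
    simpa [Algebra.ofId_apply, IsScalarTower.algebraMap_apply A S (FractionRing S)] using hab
  let ψ : FractionRing A →ₐ[A] FractionRing S := IsFractionRing.liftAlgHom hinj
  refine (isIntegrallyClosed_iff (FractionRing A)).mpr fun {x} hx => ?_
  have h1 : IsIntegral A (ψ x) := hx.map ψ
  have h2 : IsIntegral S (ψ x) := h1.tower_top
  obtain ⟨s, hs⟩ := IsIntegrallyClosed.algebraMap_eq_of_integral h2
  obtain ⟨a, b, hb, rfl⟩ := IsFractionRing.div_surjective (A := A) x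
  have hb0 : (b : S) ≠ 0 := fun h => nonZeroDivisors.ne_zero hb (Subtype.ext h)
  have hψ : ψ (algebraMap A _ a / algebraMap A _ b) =
      algebraMap S (FractionRing S) a / algebraMap S (FractionRing S) b := by
    rw [map_div₀, ψ.commutes, ψ.commutes]
    rfl
  have hsb : s * (b : S) = (a : S) := by
    apply IsFractionRing.injective S (FractionRing S)
    rw [map_mul, hs, hψ, div_mul_cancel₀]
    exact fun h => hb0 (IsFractionRing.injective S (FractionRing S) (by rw [h, map_zero]))
  have hsA : s ∈ A := fun g => by
    have h3 : g • s * (b : S) = s * (b : S) :=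
      calc g • s * (b : S) = g • s * g • (b : S) := by rw [b.2 g]
        _ = g • (s * (b : S)) := (smul_mul' g s (b : S)).symm
        _ = g • (a : S) := by rw [hsb]
        _ = (a : S) := a.2 g
        _ = s * (b : S) := hsb.symm
    exact mul_right_cancel₀ hb0 h3
  refine ⟨⟨s, hsA⟩, ?_⟩
  have hbK : algebraMap A (FractionRing A) b ≠ 0 :=
    IsFractionRing.to_map_ne_zero_of_mem_nonZeroDivisors hb
  rw [eq_div_iff hbK, ← map_mul]
  congr 1
  exact Subtype.ext hsb

namespace ActionOver

variable {X Y : Scheme.{u}} {r : X ⟶ Y} {G : Type*} [Group G] (ρ : ActionOver r G)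
  [Finite G] [Y.IsSeparated] [IsSeparated r] [IsAffine Y]
  (hcov : ∀ x : X, ∃ O : ρ.StableAffineOpens, x ∈ O.1)

omit [Finite G] [Y.IsSeparated] [IsSeparated r] [IsAffine Y] in
/-- The ring of invariant sections `Γ(X, r⁻¹U)^G` is an integrally closed domain if `Γ(X, r⁻¹U)`
is. [folklore] -/
theorem isDomain_and_isIntegrallyClosed_invariantsRing (U : Y.Opens) [IsDomain Γ(X, r ⁻¹ᵁ U)]
    [IsIntegrallyClosed Γ(X, r ⁻¹ᵁ U)] :
    IsDomain (ρ.invariantsRing U) ∧ IsIntegrallyClosed (ρ.invariantsRing U) := by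
  letI := ρ.mulSemiringAction U
  exact ⟨inferInstance, isIntegrallyClosed_fixedPoints_subring Γ(X, r ⁻¹ᵁ U) G⟩

include hcov in
/-- **`X/G` is normal when `X` is covered by `G`-stable affine opens with integrally closed
domains of sections** (its local rings are localisations of the rings of invariants `Γ(O)^G`,
which are again integrally closed domains). [folklore] -/
theorem isIntegrallyClosed_stalk_glued
    (hO : ∀ O : ρ.StableAffineOpens, (O.1 : Set X).Nonempty →
      IsDomain Γ(O.1, (O.1.ι ≫ r) ⁻¹ᵁ ⊤) ∧ IsIntegrallyClosed Γ(O.1, (O.1.ι ≫ r) ⁻¹ᵁ ⊤))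
    (z : ρ.glued) : IsIntegrallyClosed (ρ.glued.presheaf.stalk z) := by
  obtain ⟨O, x, hx, p, rfl⟩ := ρ.exists_mem_range_chart hcov z
  haveI := (hO O ⟨x, hx⟩).1
  haveI := (hO O ⟨x, hx⟩).2
  obtain ⟨h1, h2⟩ := (ρ.restrict O.1 O.2.1).isDomain_and_isIntegrallyClosed_invariantsRing ⊤
  haveI : IsDomain ((ρ.restrict O.1 O.2.1).invariants.ring ⊤) := h1
  haveI : IsIntegrallyClosed ((ρ.restrict O.1 O.2.1).invariants.ring ⊤) := h2
  have h := @Motives.isIntegrallyClosed_stalk_Spec (.of ((ρ.restrict O.1 O.2.1).invariants.ring ⊤)) h1 h2 p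
  exact @IsIntegrallyClosed.of_equiv _ _ _ _
    (asIso (((ρ.restrict O.1 O.2.1).invariants.openCover.f ⟨⊤, isAffineOpen_top Y⟩ ≫
      ρ.gluedι O).stalkMap p)).commRingCatIsoToRingEquiv.symm h

end ActionOver

/-! ### Charts of products `X₁/G₁ ×_K X₂/G₂` -/

namespace ActionOver

section Product

variable {K : Type u} [Field K] {X₁ X₂ : Scheme.{u}} {r₁ : X₁ ⟶ Spec (.of K)}
  {r₂ : X₂ ⟶ Spec (.of K)} {G₁ G₂ : Type*} [Group G₁] [Group G₂] [Finite G₁] [Finite G₂]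
  (ρ₁ : ActionOver r₁ G₁) (ρ₂ : ActionOver r₂ G₂) [IsSeparated r₁] [IsSeparated r₂]
  (hcov₁ : ∀ x : X₁, ∃ O : ρ₁.StableAffineOpens, x ∈ O.1)
  (hcov₂ : ∀ x : X₂, ∃ O : ρ₂.StableAffineOpens, x ∈ O.1)

/-- With the `K`-algebra structure `K ≅ Γ(Spec K, ⊤) → Γ(O)^G` on the ring of invariants of a
chart, the structure map of the chart is `Spec` of the algebra map. [folklore] -/
theorem specMap_algebraMap_invariants_ring (O : ρ₁.StableAffineOpens) :
    letI : Algebra K ((ρ₁.restrict O.1 O.2.1).invariants.ring ⊤) :=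
      ((((ρ₁.restrict O.1 O.2.1).invariants.diagramMap.app (op ⊤)).hom.comp
        (Scheme.ΓSpecIso (.of K)).inv.hom : K →+* ((ρ₁.restrict O.1 O.2.1).invariants.ring ⊤))).toAlgebra
    Spec.map (CommRingCat.ofHom (algebraMap K ((ρ₁.restrict O.1 O.2.1).invariants.ring ⊤))) =
      Spec.map ((ρ₁.restrict O.1 O.2.1).invariants.diagramMap.app (op ⊤)) ≫
        (Spec (.of K)).isoSpec.inv := by
  rw [Scheme.isoSpec_Spec_inv, ← Spec.map_comp]
  rfl

set_option maxHeartbeats 1000000 in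
include hcov₁ hcov₂ in
/-- **Affine charts of `X₁/G₁ ×_K X₂/G₂`**: every point lies in the image of an open immersion
from `Spec (Γ(O₁)^{G₁} ⊗_K Γ(O₂)^{G₂})` for non-empty stable affine opens `Oᵢ ⊆ Xᵢ` (products of
the charts `Spec Γ(Oᵢ)^{Gᵢ} ↪ Xᵢ/Gᵢ`, Mathlib `pullbackSpecIso`). [folklore] -/
theorem exists_chart_pullback_glued
    (w : ↥(pullback (ρ₁.gluedDesc r₁ ρ₁.aut_comp) (ρ₂.gluedDesc r₂ ρ₂.aut_comp))) :
    ∃ (O₁ : ρ₁.StableAffineOpens) (O₂ : ρ₂.StableAffineOpens),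
      (O₁.1 : Set X₁).Nonempty ∧ (O₂.1 : Set X₂).Nonempty ∧
      letI : Algebra K ((ρ₁.restrict O₁.1 O₁.2.1).invariants.ring ⊤) :=
        ((((ρ₁.restrict O₁.1 O₁.2.1).invariants.diagramMap.app (op ⊤)).hom.comp
          (Scheme.ΓSpecIso (.of K)).inv.hom : K →+* ((ρ₁.restrict O₁.1 O₁.2.1).invariants.ring ⊤))).toAlgebra
      letI : Algebra K ((ρ₂.restrict O₂.1 O₂.2.1).invariants.ring ⊤) :=
        ((((ρ₂.restrict O₂.1 O₂.2.1).invariants.diagramMap.app (op ⊤)).hom.comp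
          (Scheme.ΓSpecIso (.of K)).inv.hom : K →+* ((ρ₂.restrict O₂.1 O₂.2.1).invariants.ring ⊤))).toAlgebra
      ∃ φ : Spec (.of (TensorProduct K ((ρ₁.restrict O₁.1 O₁.2.1).invariants.ring ⊤)
          ((ρ₂.restrict O₂.1 O₂.2.1).invariants.ring ⊤))) ⟶
            pullback (ρ₁.gluedDesc r₁ ρ₁.aut_comp) (ρ₂.gluedDesc r₂ ρ₂.aut_comp),
        IsOpenImmersion φ ∧ w ∈ Set.range φ := by
  obtain ⟨O₁, x₁, hx₁, p₁, hp₁⟩ := ρ₁.exists_mem_range_chart hcov₁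
    ((pullback.fst (ρ₁.gluedDesc r₁ ρ₁.aut_comp) (ρ₂.gluedDesc r₂ ρ₂.aut_comp)) w)
  obtain ⟨O₂, x₂, hx₂, p₂, hp₂⟩ := ρ₂.exists_mem_range_chart hcov₂
    ((pullback.snd (ρ₁.gluedDesc r₁ ρ₁.aut_comp) (ρ₂.gluedDesc r₂ ρ₂.aut_comp)) w)
  refine ⟨O₁, O₂, ⟨x₁, hx₁⟩, ⟨x₂, hx₂⟩, ?_⟩
  letI : Algebra K ((ρ₁.restrict O₁.1 O₁.2.1).invariants.ring ⊤) :=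
        ((((ρ₁.restrict O₁.1 O₁.2.1).invariants.diagramMap.app (op ⊤)).hom.comp
          (Scheme.ΓSpecIso (.of K)).inv.hom : K →+* ((ρ₁.restrict O₁.1 O₁.2.1).invariants.ring ⊤))).toAlgebra
  letI : Algebra K ((ρ₂.restrict O₂.1 O₂.2.1).invariants.ring ⊤) :=
        ((((ρ₂.restrict O₂.1 O₂.2.1).invariants.diagramMap.app (op ⊤)).hom.comp
          (Scheme.ΓSpecIso (.of K)).inv.hom : K →+* ((ρ₂.restrict O₂.1 O₂.2.1).invariants.ring ⊤))).toAlgebra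
  have e₁ := (ρ₁.specMap_algebraMap_invariants_ring O₁).trans (ρ₁.chart_gluedDesc O₁).symm
  have e₂ := (ρ₂.specMap_algebraMap_invariants_ring O₂).trans (ρ₂.chart_gluedDesc O₂).symm
  let ψ := pullback.map (Spec.map (CommRingCat.ofHom (algebraMap K ((ρ₁.restrict O₁.1 O₁.2.1).invariants.ring ⊤))))
    (Spec.map (CommRingCat.ofHom (algebraMap K ((ρ₂.restrict O₂.1 O₂.2.1).invariants.ring ⊤)))) (ρ₁.gluedDesc r₁ ρ₁.aut_comp) (ρ₂.gluedDesc r₂ ρ₂.aut_comp)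
    ((ρ₁.restrict O₁.1 O₁.2.1).invariants.openCover.f ⟨⊤, isAffineOpen_top _⟩ ≫ ρ₁.gluedι O₁)
    ((ρ₂.restrict O₂.1 O₂.2.1).invariants.openCover.f ⟨⊤, isAffineOpen_top _⟩ ≫ ρ₂.gluedι O₂)
    (𝟙 _) ((Category.comp_id _).trans e₁) ((Category.comp_id _).trans e₂)
  have hψ : IsOpenImmersion ψ :=
    MorphismProperty.pullbackMap (P := @IsOpenImmersion) (ρ₁.isOpenImmersion_chart O₁)
      (ρ₂.isOpenImmersion_chart O₂) e₁ e₂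
  refine ⟨(pullbackSpecIso K ((ρ₁.restrict O₁.1 O₁.2.1).invariants.ring ⊤) ((ρ₂.restrict O₂.1 O₂.2.1).invariants.ring ⊤)).inv ≫ ψ, inferInstance, ?_⟩
  have hw : w ∈ Set.range ψ := by
    rw [Scheme.Pullback.range_map]
    exact ⟨⟨p₁, hp₁⟩, ⟨p₂, hp₂⟩⟩
  obtain ⟨v, rfl⟩ := hw
  refine ⟨(pullbackSpecIso K ((ρ₁.restrict O₁.1 O₁.2.1).invariants.ring ⊤) ((ρ₂.restrict O₂.1 O₂.2.1).invariants.ring ⊤)).hom v, ?_⟩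
  change ((pullbackSpecIso K ((ρ₁.restrict O₁.1 O₁.2.1).invariants.ring ⊤) ((ρ₂.restrict O₂.1 O₂.2.1).invariants.ring ⊤)).hom ≫
    (pullbackSpecIso K ((ρ₁.restrict O₁.1 O₁.2.1).invariants.ring ⊤) ((ρ₂.restrict O₂.1 O₂.2.1).invariants.ring ⊤)).inv ≫ ψ) v = ψ v
  rw [Iso.hom_inv_id_assoc]

set_option maxHeartbeats 1000000 in
include hcov₁ hcov₂ in
/-- **`X₁/G₁ ×_K X₂/G₂` is normal** (characteristic zero) **when the products `O₁ ×_K O₂` of the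
stable affine charts have integrally closed domains of sections `Γ(O₁) ⊗_K Γ(O₂)`**: its local
rings are localisations of `Γ(O₁)^{G₁} ⊗_K Γ(O₂)^{G₂} ≅ (Γ(O₁) ⊗_K Γ(O₂))^{G₁ × G₂}` (Reynolds
operators, `isDomain_and_isIntegrallyClosed_tensorProduct_fixedPoints`). [folklore] -/
theorem isIntegrallyClosed_stalk_pullback_glued [CharZero K]
    (hT : ∀ (O₁ : ρ₁.StableAffineOpens) (O₂ : ρ₂.StableAffineOpens),
      (O₁.1 : Set X₁).Nonempty → (O₂.1 : Set X₂).Nonempty →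
      letI : Algebra K Γ(O₁.1, (O₁.1.ι ≫ r₁) ⁻¹ᵁ ⊤) :=
        ((((O₁.1.ι ≫ r₁).app ⊤).hom.comp (Scheme.ΓSpecIso (.of K)).inv.hom :
          K →+* Γ(O₁.1, (O₁.1.ι ≫ r₁) ⁻¹ᵁ ⊤))).toAlgebra
      letI : Algebra K Γ(O₂.1, (O₂.1.ι ≫ r₂) ⁻¹ᵁ ⊤) :=
        ((((O₂.1.ι ≫ r₂).app ⊤).hom.comp (Scheme.ΓSpecIso (.of K)).inv.hom :
          K →+* Γ(O₂.1, (O₂.1.ι ≫ r₂) ⁻¹ᵁ ⊤))).toAlgebra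
      IsDomain (TensorProduct K Γ(O₁.1, (O₁.1.ι ≫ r₁) ⁻¹ᵁ ⊤) Γ(O₂.1, (O₂.1.ι ≫ r₂) ⁻¹ᵁ ⊤)) ∧
        IsIntegrallyClosed (TensorProduct K Γ(O₁.1, (O₁.1.ι ≫ r₁) ⁻¹ᵁ ⊤) Γ(O₂.1, (O₂.1.ι ≫ r₂) ⁻¹ᵁ ⊤)))
    (w : ↥(pullback (ρ₁.gluedDesc r₁ ρ₁.aut_comp) (ρ₂.gluedDesc r₂ ρ₂.aut_comp))) :
    IsIntegrallyClosed ((pullback (ρ₁.gluedDesc r₁ ρ₁.aut_comp)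
      (ρ₂.gluedDesc r₂ ρ₂.aut_comp)).presheaf.stalk w) := by
  obtain ⟨O₁, O₂, hO₁, hO₂, φ, hφ, v, rfl⟩ := exists_chart_pullback_glued ρ₁ ρ₂ hcov₁ hcov₂ w
  -- actions and `K`-algebra structures on the rings of sections and of invariants
  letI m₁ := (ρ₁.restrict O₁.1 O₁.2.1).mulSemiringAction ⊤
  letI m₂ := (ρ₂.restrict O₂.1 O₂.2.1).mulSemiringAction ⊤
  letI a₁ : Algebra K Γ(O₁.1, (O₁.1.ι ≫ r₁) ⁻¹ᵁ ⊤) :=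
    ((((O₁.1.ι ≫ r₁).app ⊤).hom.comp (Scheme.ΓSpecIso (.of K)).inv.hom : K →+* Γ(O₁.1, (O₁.1.ι ≫ r₁) ⁻¹ᵁ ⊤))).toAlgebra
  letI a₂ : Algebra K Γ(O₂.1, (O₂.1.ι ≫ r₂) ⁻¹ᵁ ⊤) :=
    ((((O₂.1.ι ≫ r₂).app ⊤).hom.comp (Scheme.ΓSpecIso (.of K)).inv.hom : K →+* Γ(O₂.1, (O₂.1.ι ≫ r₂) ⁻¹ᵁ ⊤))).toAlgebra
  letI i₁ : Algebra K ((ρ₁.restrict O₁.1 O₁.2.1).invariants.ring ⊤) :=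
    ((((ρ₁.restrict O₁.1 O₁.2.1).invariants.diagramMap.app (op ⊤)).hom.comp
      (Scheme.ΓSpecIso (.of K)).inv.hom : K →+* ((ρ₁.restrict O₁.1 O₁.2.1).invariants.ring ⊤))).toAlgebra
  letI i₂ : Algebra K ((ρ₂.restrict O₂.1 O₂.2.1).invariants.ring ⊤) :=
    ((((ρ₂.restrict O₂.1 O₂.2.1).invariants.diagramMap.app (op ⊤)).hom.comp
      (Scheme.ΓSpecIso (.of K)).inv.hom : K →+* ((ρ₂.restrict O₂.1 O₂.2.1).invariants.ring ⊤))).toAlgebra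
  -- sections from the base are invariant: the action commutes with scalars
  haveI : SMulCommClass G₁ K Γ(O₁.1, (O₁.1.ι ≫ r₁) ⁻¹ᵁ ⊤) := ⟨fun g c a ↦ by
    rw [Algebra.smul_def, Algebra.smul_def, smul_mul', (ρ₁.restrict O₁.1 O₁.2.1).smul_def ⊤ g
      (algebraMap K Γ(O₁.1, (O₁.1.ι ≫ r₁) ⁻¹ᵁ ⊤) c)]
    congr 1
    exact (ρ₁.restrict O₁.1 O₁.2.1).act_app g ⊤ _⟩
  haveI : SMulCommClass G₂ K Γ(O₂.1, (O₂.1.ι ≫ r₂) ⁻¹ᵁ ⊤) := ⟨fun g c a ↦ by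
    rw [Algebra.smul_def, Algebra.smul_def, smul_mul', (ρ₂.restrict O₂.1 O₂.2.1).smul_def ⊤ g
      (algebraMap K Γ(O₂.1, (O₂.1.ι ≫ r₂) ⁻¹ᵁ ⊤) c)]
    congr 1
    exact (ρ₂.restrict O₂.1 O₂.2.1).act_app g ⊤ _⟩
  -- `A₁^G ⊗ A₂^H` is an integrally closed domain
  obtain ⟨hd, hn⟩ := hT O₁ O₂ hO₁ hO₂
  haveI := hd
  haveI := hn
  obtain ⟨hd', hn'⟩ := isDomain_and_isIntegrallyClosed_tensorProduct_fixedPoints K Γ(O₁.1, (O₁.1.ι ≫ r₁) ⁻¹ᵁ ⊤) Γ(O₂.1, (O₂.1.ι ≫ r₂) ⁻¹ᵁ ⊤) G₁ G₂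
  -- the rings of invariants, as `K`-algebras, are the `FixedPoints.subalgebra`s (same carriers)
  let f₁ : ((ρ₁.restrict O₁.1 O₁.2.1).invariants.ring ⊤) →ₐ[K] FixedPoints.subalgebra K Γ(O₁.1, (O₁.1.ι ≫ r₁) ⁻¹ᵁ ⊤) G₁ :=
    { toFun := fun x ↦ ⟨x.1, x.2⟩
      map_one' := rfl
      map_mul' := fun _ _ ↦ rfl
      map_zero' := rfl
      map_add' := fun _ _ ↦ rfl
      commutes' := fun _ ↦ rfl }
  let e₁ := AlgEquiv.ofBijective f₁ ⟨fun x y h ↦ Subtype.ext (congrArg Subtype.val h),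
    fun y ↦ ⟨⟨y.1, y.2⟩, rfl⟩⟩
  let f₂ : ((ρ₂.restrict O₂.1 O₂.2.1).invariants.ring ⊤) →ₐ[K] FixedPoints.subalgebra K Γ(O₂.1, (O₂.1.ι ≫ r₂) ⁻¹ᵁ ⊤) G₂ :=
    { toFun := fun x ↦ ⟨x.1, x.2⟩
      map_one' := rfl
      map_mul' := fun _ _ ↦ rfl
      map_zero' := rfl
      map_add' := fun _ _ ↦ rfl
      commutes' := fun _ ↦ rfl }
  let e₂ := AlgEquiv.ofBijective f₂ ⟨fun x y h ↦ Subtype.ext (congrArg Subtype.val h),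
    fun y ↦ ⟨⟨y.1, y.2⟩, rfl⟩⟩
  let e := Algebra.TensorProduct.congr e₁ e₂
  haveI : IsDomain (TensorProduct K ((ρ₁.restrict O₁.1 O₁.2.1).invariants.ring ⊤) ((ρ₂.restrict O₂.1 O₂.2.1).invariants.ring ⊤)) := e.injective.isDomain e.toRingHom
  haveI hn'' : IsIntegrallyClosed (TensorProduct K ((ρ₁.restrict O₁.1 O₁.2.1).invariants.ring ⊤) ((ρ₂.restrict O₂.1 O₂.2.1).invariants.ring ⊤)) :=
    @IsIntegrallyClosed.of_equiv _ _ _ _ e.symm.toRingEquiv hn'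
  have h := Motives.isIntegrallyClosed_stalk_Spec (.of (TensorProduct K ((ρ₁.restrict O₁.1 O₁.2.1).invariants.ring ⊤) ((ρ₂.restrict O₂.1 O₂.2.1).invariants.ring ⊤))) v
  exact @IsIntegrallyClosed.of_equiv _ _ _ _ (asIso (φ.stalkMap v)).commRingCatIsoToRingEquiv.symm h

end Product

end ActionOver

/-! ### Smooth affine schemes over a field have integrally closed domains of sections -/

/-- **The ring of global sections of an integral affine scheme smooth over a field is an
integrally closed domain** (its local rings are regular, Görtz–Wedhorn I Lemma 6.26, so the ring is
regular, and regular domains are normal, Matsumura 19.4). [cite: GortzWedhorn2020, Lemma 6.26] -/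
theorem isIntegrallyClosed_sections_of_smoothOfRelativeDimension {K : Type u} [Field K]
    {Z : Scheme.{u}} [IsAffine Z] [IsIntegral Z] (f : Z ⟶ Spec (.of K)) (d : ℕ)
    [SmoothOfRelativeDimension d f] (U : Z.Opens) (hU : U = ⊤) :
    IsDomain Γ(Z, U) ∧ IsIntegrallyClosed Γ(Z, U) := by
  subst hU
  haveI : Smooth f := SmoothOfRelativeDimension.smooth d f
  haveI : IsLocallyNoetherian Z := LocallyOfFiniteType.isLocallyNoetherian f
  haveI : IsRegularRing Γ(Z, ⊤) := Motives.isRegularRing_of_isAffineOpen (isAffineOpen_top Z)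
    fun z ↦ Motives.isRegularLocalRing_stalk_of_smoothOfRelativeDimension f d z
  exact ⟨inferInstance, Resolution.isIntegrallyClosed_of_isRegularRing Γ(Z, ⊤)⟩

/-! ### Products of smooth affine opens: `Γ(O₁) ⊗_K Γ(O₂)` is an integrally closed domain -/

section TensorSections

open TensorProduct

variable {K : Type u} [Field K] {P₁ P₂ : Scheme.{u}} (f₁ : P₁ ⟶ Spec (.of K))
  (f₂ : P₂ ⟶ Spec (.of K)) (d₁ d₂ : ℕ) [SmoothOfRelativeDimension d₁ f₁]
  [SmoothOfRelativeDimension d₂ f₂] [IsIntegral (pullback f₁ f₂)]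
  (O₁ : P₁.Opens) (O₂ : P₂.Opens) [IsAffine (O₁ : Scheme.{u})] [IsAffine (O₂ : Scheme.{u})]

/-- With the `K`-algebra structure `K ≅ Γ(Spec K, ⊤) → Γ(O, ⊤)` on the sections of an affine
open `O` of a `K`-scheme, `Spec` of the algebra map is `O ≅ Spec Γ(O, ⊤)` followed by
`O → Spec K`. [folklore] -/
theorem specMap_algebraMap_sections (O : P₁.Opens) [IsAffine (O : Scheme.{u})] :
    letI : Algebra K Γ(O, (O.ι ≫ f₁) ⁻¹ᵁ ⊤) :=
        ((((O.ι ≫ f₁).app ⊤).hom.comp (Scheme.ΓSpecIso (.of K)).inv.hom :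
          K →+* Γ(O, (O.ι ≫ f₁) ⁻¹ᵁ ⊤))).toAlgebra
    Spec.map (CommRingCat.ofHom (algebraMap K Γ(O, (O.ι ≫ f₁) ⁻¹ᵁ ⊤))) =
      (O : Scheme.{u}).isoSpec.inv ≫ O.ι ≫ f₁ := by
  rw [← Scheme.isoSpec_inv_naturality, Scheme.isoSpec_Spec_inv, ← Spec.map_comp]
  rfl

include d₁ d₂ in
/-- **For non-empty affine opens `Oᵢ` of `K`-schemes `Pᵢ` smooth over the field `K` with
`P₁ ×_K P₂` integral, `Γ(O₁) ⊗_K Γ(O₂)` is an integrally closed domain**: its spectrum is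
`O₁ ×_K O₂`, a non-empty open of `P₁ ×_K P₂`, integral and smooth over `K`
(`isIntegrallyClosed_sections_of_smoothOfRelativeDimension`). [cite: GortzWedhorn2020, Lemma 6.26] -/
theorem isDomain_and_isIntegrallyClosed_tensor_sections (h₁ : (O₁ : Set P₁).Nonempty)
    (h₂ : (O₂ : Set P₂).Nonempty) :
    letI : Algebra K Γ(O₁, (O₁.ι ≫ f₁) ⁻¹ᵁ ⊤) :=
        ((((O₁.ι ≫ f₁).app ⊤).hom.comp (Scheme.ΓSpecIso (.of K)).inv.hom :
          K →+* Γ(O₁, (O₁.ι ≫ f₁) ⁻¹ᵁ ⊤))).toAlgebra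
    letI : Algebra K Γ(O₂, (O₂.ι ≫ f₂) ⁻¹ᵁ ⊤) :=
        ((((O₂.ι ≫ f₂).app ⊤).hom.comp (Scheme.ΓSpecIso (.of K)).inv.hom :
          K →+* Γ(O₂, (O₂.ι ≫ f₂) ⁻¹ᵁ ⊤))).toAlgebra
    IsDomain (Γ(O₁, (O₁.ι ≫ f₁) ⁻¹ᵁ ⊤) ⊗[K] Γ(O₂, (O₂.ι ≫ f₂) ⁻¹ᵁ ⊤)) ∧
      IsIntegrallyClosed (Γ(O₁, (O₁.ι ≫ f₁) ⁻¹ᵁ ⊤) ⊗[K] Γ(O₂, (O₂.ι ≫ f₂) ⁻¹ᵁ ⊤)) := by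
  letI : Algebra K Γ(O₁, (O₁.ι ≫ f₁) ⁻¹ᵁ ⊤) :=
        ((((O₁.ι ≫ f₁).app ⊤).hom.comp (Scheme.ΓSpecIso (.of K)).inv.hom :
          K →+* Γ(O₁, (O₁.ι ≫ f₁) ⁻¹ᵁ ⊤))).toAlgebra
  letI : Algebra K Γ(O₂, (O₂.ι ≫ f₂) ⁻¹ᵁ ⊤) :=
        ((((O₂.ι ≫ f₂).app ⊤).hom.comp (Scheme.ΓSpecIso (.of K)).inv.hom :
          K →+* Γ(O₂, (O₂.ι ≫ f₂) ⁻¹ᵁ ⊤))).toAlgebra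
  -- `Spec (A₁ ⊗ A₂) ≅ O₁ ×_K O₂ ↪ P₁ ×_K P₂`
  have e₁ := specMap_algebraMap_sections f₁ O₁
  have e₂ := specMap_algebraMap_sections f₂ O₂
  let Z := pullback (O₁.ι ≫ f₁) (O₂.ι ≫ f₂)
  let j : Z ⟶ pullback f₁ f₂ := pullback.map _ _ _ _ O₁.ι O₂.ι (𝟙 _)
    ((Category.comp_id _).trans rfl) ((Category.comp_id _).trans rfl)
  haveI hj : IsOpenImmersion j := MorphismProperty.pullbackMap (P := @IsOpenImmersion)
    (inferInstanceAs (IsOpenImmersion O₁.ι)) (inferInstanceAs (IsOpenImmersion O₂.ι)) rfl rfl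
  -- `Z` is integral and smooth over `K`
  haveI : Nonempty Z := by
    obtain ⟨x₁, hx₁⟩ := h₁
    obtain ⟨x₂, hx₂⟩ := h₂
    obtain ⟨z, -⟩ := Scheme.Pullback.exists_preimage_pullback (f := O₁.ι ≫ f₁) (g := O₂.ι ≫ f₂)
      (⟨x₁, hx₁⟩ : O₁) (⟨x₂, hx₂⟩ : O₂) (Subsingleton.elim (α := PrimeSpectrum K) _ _)
    exact ⟨z⟩
  haveI : IsIntegral Z := isIntegral_of_isOpenImmersion j
  haveI := smoothOfRelativeDimension_isStableUnderBaseChange (n := 0 + d₂)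
  haveI : SmoothOfRelativeDimension (0 + d₂) (pullback.fst (O₁.ι ≫ f₁) (O₂.ι ≫ f₂)) :=
    MorphismProperty.pullback_fst _ _ (inferInstance : SmoothOfRelativeDimension (0 + d₂) (O₂.ι ≫ f₂))
  haveI : SmoothOfRelativeDimension ((0 + d₂) + (0 + d₁))
      (pullback.fst (O₁.ι ≫ f₁) (O₂.ι ≫ f₂) ≫ O₁.ι ≫ f₁) := inferInstance
  -- transport to `Spec (A₁ ⊗ A₂)`
  let e : pullback (Spec.map (CommRingCat.ofHom (algebraMap K Γ(O₁, (O₁.ι ≫ f₁) ⁻¹ᵁ ⊤))))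
      (Spec.map (CommRingCat.ofHom (algebraMap K Γ(O₂, (O₂.ι ≫ f₂) ⁻¹ᵁ ⊤)))) ⟶ Z :=
    pullback.map _ _ _ _ (O₁ : Scheme.{u}).isoSpec.inv (O₂ : Scheme.{u}).isoSpec.inv (𝟙 _)
      (by rw [Category.comp_id]; exact e₁) (by rw [Category.comp_id]; exact e₂)
  haveI : IsIso e := inferInstance
  let ι : Spec (.of (Γ(O₁, (O₁.ι ≫ f₁) ⁻¹ᵁ ⊤) ⊗[K] Γ(O₂, (O₂.ι ≫ f₂) ⁻¹ᵁ ⊤))) ⟶ Z :=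
    (pullbackSpecIso K _ _).inv ≫ e
  haveI : IsIso ι := inferInstance
  haveI : IsIntegral (Spec (.of (Γ(O₁, (O₁.ι ≫ f₁) ⁻¹ᵁ ⊤) ⊗[K] Γ(O₂, (O₂.ι ≫ f₂) ⁻¹ᵁ ⊤)))) :=
    IsIntegral.of_isIso (inv ι)
  haveI : SmoothOfRelativeDimension (0 + ((0 + d₂) + (0 + d₁)))
      (ι ≫ pullback.fst (O₁.ι ≫ f₁) (O₂.ι ≫ f₂) ≫ O₁.ι ≫ f₁) := inferInstance
  obtain ⟨hd, hn⟩ := isIntegrallyClosed_sections_of_smoothOfRelativeDimension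
    (ι ≫ pullback.fst (O₁.ι ≫ f₁) (O₂.ι ≫ f₂) ≫ O₁.ι ≫ f₁) (0 + ((0 + d₂) + (0 + d₁))) ⊤ rfl
  let eΓ := (Scheme.ΓSpecIso (.of (Γ(O₁, (O₁.ι ≫ f₁) ⁻¹ᵁ ⊤) ⊗[K]
    Γ(O₂, (O₂.ι ≫ f₂) ⁻¹ᵁ ⊤)))).commRingCatIsoToRingEquiv
  haveI := hd
  exact ⟨eΓ.symm.injective.isDomain eΓ.symm.toRingHom, @IsIntegrallyClosed.of_equiv _ _ _ _ eΓ hn⟩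

end TensorSections

/-! ### The symmetric powers `X⁽ⁿ⁾` of a smooth `X` over a field, and their products, are normal -/

section SymPow

variable {K : Type u} [Field K] {X : Scheme.{u}} (r : X ⟶ Spec (.of K)) (d n : ℕ)
  [SmoothOfRelativeDimension d r] [IsSeparated r] (hX : FiniteSubsetsInAffineOpens r)

include hX d in
/-- **The symmetric power `X⁽ⁿ⁾ = Xⁿ/𝔖ₙ` of a smooth separated `X` over a field (all of whose
finite subsets lie in affine opens, e.g. `X` quasi-projective) is NORMAL**: it is covered by the
quotients `Spec Γ(Wⁿ)^{𝔖ₙ}` of smooth affine `𝔖ₙ`-stable opens, and rings of invariants of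
integrally closed domains are integrally closed domains (Milne, *Jacobian Varieties*, §3
Prop. 3.2: `C^{(r)}` is even nonsingular for a curve; Mumford, *Abelian Varieties*, §7). [cite: Milne1986JacobianVarieties, §3 Prop. 3.1–3.2] -/
theorem isIntegrallyClosed_stalk_symPowGlued [IsIntegral (powOver r n)] (z : symPowGlued r n) :
    IsIntegrallyClosed ((symPowGlued r n).presheaf.stalk z) := by
  refine (permAction r n).isIntegrallyClosed_stalk_glued (exists_stableAffineOpen_mem hX) ?_ z
  intro O hO
  haveI : IsAffine (O.1 : Scheme.{u}) := isAffine_of_isAffineHom (O.1.ι ≫ powOver.base r n)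
  haveI : Nonempty (O.1 : Scheme.{u}) := by
    obtain ⟨x, hx⟩ := hO
    exact ⟨⟨x, hx⟩⟩
  haveI : IsIntegral (O.1 : Scheme.{u}) := isIntegral_of_isOpenImmersion O.1.ι
  haveI := smoothOfRelativeDimension_powOver_base r d n
  haveI : SmoothOfRelativeDimension (0 + n * d) (O.1.ι ≫ powOver.base r n) := inferInstance
  exact isIntegrallyClosed_sections_of_smoothOfRelativeDimension (O.1.ι ≫ powOver.base r n) (0 + n * d)
    _ rfl

include hX d in
/-- **`X⁽ⁿ⁾ ×_K X⁽ᵐ⁾` is normal** (characteristic zero; `X` smooth and separated over `K` with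
finite subsets in affine opens, `Xⁿ ×_K Xᵐ` integral): its local rings are localisations of the
rings `Γ(Wⁿ)^{𝔖ₙ} ⊗_K Γ(W'ᵐ)^{𝔖ₘ} ≅ (Γ(Wⁿ) ⊗_K Γ(W'ᵐ))^{𝔖ₙ × 𝔖ₘ}`, rings of invariants (via
Reynolds operators) in the integrally closed domains of sections of the smooth affine
`Wⁿ ×_K W'ᵐ`. [cite: Milne1986JacobianVarieties, §3 Prop. 3.1–3.2] -/
theorem isIntegrallyClosed_stalk_pullback_symPowGlued_base [CharZero K] (m : ℕ)
    [IsIntegral (pullback (powOver.base r n) (powOver.base r m))]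
    (w : ↥(pullback (symPowGlued.base r n) (symPowGlued.base r m))) :
    IsIntegrallyClosed ((pullback (symPowGlued.base r n) (symPowGlued.base r m)).presheaf.stalk w) := by
  haveI := smoothOfRelativeDimension_powOver_base r d n
  haveI := smoothOfRelativeDimension_powOver_base r d m
  refine (permAction r n).isIntegrallyClosed_stalk_pullback_glued (permAction r m)
    (exists_stableAffineOpen_mem hX) (exists_stableAffineOpen_mem hX) ?_ w
  intro O₁ O₂ hO₁ hO₂
  haveI : IsAffine (O₁.1 : Scheme.{u}) := isAffine_of_isAffineHom (O₁.1.ι ≫ powOver.base r n)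
  haveI : IsAffine (O₂.1 : Scheme.{u}) := isAffine_of_isAffineHom (O₂.1.ι ≫ powOver.base r m)
  exact isDomain_and_isIntegrallyClosed_tensor_sections (powOver.base r n) (powOver.base r m)
    (n * d) (m * d) O₁.1 O₂.1 hO₁ hO₂

end SymPow

end Literature.AlgebraicGeometry.RelativeSpec

/-! ### The projective symmetric powers `C⁽ⁿ⁾ = symPowProj C hC n` and their products are normal -/

namespace Literature.AlgebraicGeometry.Motives

open Literature.AlgebraicGeometry.RelativeSpec MonoidalCategory

variable {K : Type u} [Field K] (C : SchemeOver K) (hC : IsProjectiveOver C) (d : ℕ)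
  [SmoothOfRelativeDimension d C.hom]

include d in
/-- **The symmetric power `C⁽ⁿ⁾` of a smooth projective `C` is normal** (for a curve it is even
nonsingular, Milne, *Jacobian Varieties*, §3 Prop. 3.2; normality is what Weil's construction
of the Jacobian uses, §7). [cite: Milne1986JacobianVarieties, §3 Prop. 3.1–3.2] -/
theorem symPowProj.isIntegrallyClosed_stalk (n : ℕ) [IsIntegral (powOverObj C.hom n).left]
    (t : ↥(symPowProj C hC n).left) :
    IsIntegrallyClosed ((symPowProj C hC n).left.presheaf.stalk t) := by
  haveI := hC.isSeparated
  haveI : IsIntegral (powOver C.hom n) := inferInstanceAs (IsIntegral (powOverObj C.hom n).left)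
  exact isIntegrallyClosed_stalk_symPowGlued C.hom d n hC.finiteSubsetsInAffineOpens t

include d in
/-- **`C⁽ⁿ⁾ ×_K C⁽ᵐ⁾` is normal** (characteristic zero). [cite: Milne1986JacobianVarieties, §3 Prop. 3.1–3.2] -/
theorem symPowProj.isIntegrallyClosed_stalk_tensor [CharZero K] (n m : ℕ)
    [IsIntegral (powOverObj C.hom n).left]
    [IsIntegral (powOverObj C.hom n ⊗ powOverObj C.hom m).left]
    (t : ↥(symPowProj C hC n ⊗ symPowProj C hC m).left) :
    IsIntegrallyClosed ((symPowProj C hC n ⊗ symPowProj C hC m).left.presheaf.stalk t) := by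
  haveI := hC.isSeparated
  haveI : IsIntegral (powOver C.hom n) := inferInstanceAs (IsIntegral (powOverObj C.hom n).left)
  haveI : IsIntegral (pullback (powOver.base C.hom n) (powOver.base C.hom m)) :=
    inferInstanceAs (IsIntegral (powOverObj C.hom n ⊗ powOverObj C.hom m).left)
  exact isIntegrallyClosed_stalk_pullback_symPowGlued_base C.hom d n hC.finiteSubsetsInAffineOpens m t

end Literature.AlgebraicGeometry.Motives

end
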